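import Literature.AnabelianGeometry.SemiGraphs.TemperedMaximalCompactAt
import Literature.AnabelianGeometry.SemiGraphs.TemperedMaximalCompactProofs
import HarnessLib

/-!
# [SemiAnbd] Thm 3.7 (iv) from (i), (ii), (iii) — the rung-4 residual discharged — PER-GRAPH twin (cell
ruling φ2 / α4-3 (ii))

Mochizuki, *Semi-graphs of anabelioids*, Publ. RIMS **42** (2006), §3, Theorem 3.7 (ii)–(iv), manuscript
pp. 40–41 [cite: MochizukiSemiAnbd2006, Thm 3.7(iii)(iv) pp.40-41].

PROOF-ONLY companion of `TemperedMaximalCompactProofs.lean` (abc-iut cell wave-4 seat abc-iut-w4-d075,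
L3-lead ruling α4-3 (ii)
«φ2-CONSUMERS»): the same theorems with the ∀-countable named facts `CompactInVerticial` /
`MaximalCompactIffVerticial` / `EdgeLikeIsInfVerticial` / `EdgeLikeDistinct` replaced by their per-graph
forms `…At 𝒢` (`TemperedCompactInVerticialAt.lean`), so that the finite-`𝔾` producer
(`compactInVerticialAt_of_finiteLevelData`) feeds them; proofs ported VERBATIM with `hCV 𝒢 ↦ hCV`
(the `Thm37Hypotheses` argument stays).  Original file untouched.  No definitions, no new named fact;
nothing here asserts Thm 3.7 (iii) for an infinite `𝔾`, and nothing bears on [IUTchIII] Cor. 3.12.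
-/

namespace Literature.AnabelianGeometry.SemiGraphs

namespace ProfiniteSemiGraph

open Topology

universe u w

variable {𝒢 ℋ : ProfiniteSemiGraph.{u}}

/-- **The residual of G10 rung 4, DISCHARGED**: `EdgeLikeIsInfVerticial` — a nontrivial edge-like subgroup of
a closed edge is the intersection of two distinct verticial subgroups — from Thm 3.7 (i), (ii), (iii).
[cite: MochizukiSemiAnbd2006, Thm 3.7(iv) p.41] -/
theorem edgeLikeIsInfVerticialAt_of (hCV : CompactInVerticialAt 𝒢) (hVD : VerticialDistinct.{u})
    (hVI : VerticialInjective.{u}) : EdgeLikeIsInfVerticialAt 𝒢 := by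
  intro h𝒢 c e he L hL hLne
  classical
  haveI := TemperedPiChart.t2Space c
  have hΦ' : ∀ v : 𝒢.graph.Vertex, ∃ φ : 𝒢.Gv v →ₜ* c.G, IsVerticialHom c v φ := by
    intro v
    obtain ⟨H, φ, hφ, -⟩ := (hVI 𝒢 h𝒢 c v).1
    exact ⟨φ, hφ⟩
  choose Φ hΦ using hΦ'
  -- the two branches of the closed edge and the two presentations of `L`
  obtain ⟨b, b', u, u', hbb', hbe, hb'e, hb, hb'⟩ := SemiGraph.exists_branches_of_isClosedEdge he
  subst hbe
  obtain ⟨g, hLeq⟩ := edgeLike_eq_map_branchSubgroup c hb hL (Φ u) (hΦ u)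
  have hLb' : L ∈ edgeLikeSubgroups c (𝒢.graph.edgeOf b') := by rw [hb'e]; exact hL
  obtain ⟨g', hLeq'⟩ := edgeLike_eq_map_branchSubgroup c hb' hLb' (Φ u') (hΦ u')
  set H := (Φ u).toMonoidHom.range.map (MulAut.conj g).toMonoidHom with hHdef
  set H' := (Φ u').toMonoidHom.range.map (MulAut.conj g').toMonoidHom with hH'def
  have hHm : H ∈ verticialSubgroups c u :=
    conj_mem_verticialSubgroups c (range_mem_verticialSubgroups c (Φ u) (hΦ u)) g
  have hH'm : H' ∈ verticialSubgroups c u' :=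
    conj_mem_verticialSubgroups c (range_mem_verticialSubgroups c (Φ u') (hΦ u')) g'
  have hLH : L ≤ H := by rw [hLeq]; exact Subgroup.map_mono (Subgroup.map_le_range _ _)
  have hLH' : L ≤ H' := by rw [hLeq']; exact Subgroup.map_mono (Subgroup.map_le_range _ _)
  -- the hosts are distinct (LEMMA E)
  have hHH' : H ≠ H' := by
    intro hHH'
    refine hbb' (branch_eq_of_hosts_eq hVD hVI h𝒢 c Φ hΦ hLne hb hb' g g' ?_ ?_ hHH')
    · rw [← hLeq]
    · rw [← hLeq']
  refine ⟨u, u', H, H', hHm, hH'm, hHH', le_antisymm (le_inf hLH hLH') ?_⟩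
  -- `K = H ⊓ H'` is compact, nontrivial, with hosts `H`, `H'`
  have hKc : IsCompact ((H ⊓ H' : Subgroup c.G) : Set c.G) := by
    rw [Subgroup.coe_inf]
    exact (isCompact_of_mem_verticialSubgroups c hHm).inter_right
      (isCompact_of_mem_verticialSubgroups c hH'm).isClosed
  have hKne : H ⊓ H' ≠ ⊥ := fun h => hLne (le_bot_iff.mp (h ▸ le_inf hLH hLH'))
  obtain ⟨honly, e'', L'', he'', hL'', hKL''⟩ :=
    (hCV h𝒢 c (H ⊓ H') hKc).2 hKne u u' H H' hHm hH'm hHH' inf_le_left inf_le_right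
  obtain ⟨b'', -, u'', -, -, hbe'', -, hb'', -⟩ := SemiGraph.exists_branches_of_isClosedEdge he''
  subst hbe''
  obtain ⟨g'', hLeq''⟩ := edgeLike_eq_map_branchSubgroup c hb'' hL'' (Φ u'') (hΦ u'')
  set H'' := (Φ u'').toMonoidHom.range.map (MulAut.conj g'').toMonoidHom with hH''def
  have hH''m : H'' ∈ verticialSubgroups c u'' :=
    conj_mem_verticialSubgroups c (range_mem_verticialSubgroups c (Φ u'') (hΦ u'')) g''
  have hKH'' : H ⊓ H' ≤ H'' :=
    hKL''.trans (by rw [hLeq'']; exact Subgroup.map_mono (Subgroup.map_le_range _ _))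
  have hLL'' : L ≤ L'' := (le_inf hLH hLH').trans hKL''
  -- the host of `L''` is `H` or `H'`; in either case `L'' = L`
  have hLne₁ : ((𝒢.branchSubgroup b u hb).map (Φ u).toMonoidHom).map (MulAut.conj g).toMonoidHom ≠ ⊥ := by
    rw [← hLeq]; exact hLne
  have hLne₂ : ((𝒢.branchSubgroup b' u' hb').map (Φ u').toMonoidHom).map (MulAut.conj g').toMonoidHom ≠ ⊥ := by
    rw [← hLeq']; exact hLne
  rcases honly u'' H'' hH''m hKH'' with h1 | h2
  · have := map_branch_eq_of_le_of_hosts_eq hVD hVI h𝒢 c Φ hΦ hb hb'' g g'' hLne₁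
      (by rw [← hLeq, ← hLeq'']; exact hLL'') h1.symm
    rw [← hLeq'', ← hLeq] at this
    rw [← this]; exact hKL''
  · have := map_branch_eq_of_le_of_hosts_eq hVD hVI h𝒢 c Φ hΦ hb' hb'' g' g'' hLne₂
      (by rw [← hLeq', ← hLeq'']; exact hLL'') h2.symm
    rw [← hLeq'', ← hLeq'] at this
    rw [← this]; exact hKL''

/-- **[SemiAnbd] Thm 3.7 (iv) from (i), (ii), (iii)** (G10 rung 4 closed modulo rungs 1–3): maximal compact ⇔
verticial, and the nontrivial intersections of two distinct maximal compact subgroups are exactly the edge-like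
subgroups of closed edges. [cite: MochizukiSemiAnbd2006, Thm 3.7(iv) p.41] -/
theorem maximalCompactIffVerticialAt_of_thm37 (hCV : CompactInVerticialAt 𝒢) (hVD : VerticialDistinct.{u})
    (hVI : VerticialInjective.{u}) : MaximalCompactIffVerticialAt 𝒢 :=
  maximalCompactIffVerticialAt_of hCV hVD (edgeLikeIsInfVerticialAt_of hCV hVD hVI)

end ProfiniteSemiGraph

end Literature.AnabelianGeometry.SemiGraphs
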